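import Literature.MathematicalPhysics.KineticTheory.DiPernaLionsGainLeLoss
import Literature.MathematicalPhysics.KineticTheory.VelocityAveragingProofs
import HarnessLib

/-!
# Discharged fact (E49): `Q± ≤ 2 Q∓ + E` for the DiPerna–Lions weak limit

Topic: MathematicalPhysics / KineticTheory. The named fact (E49)
`Literature.MathematicalPhysics.KineticTheory.diPernaLions_limit_gain_le_loss` of
`DiPernaLionsMildLimit` (Cercignani–Illner–Pulvirenti 1994 §5.3 Step 14, (3.46)–(3.49),
pp. 159–160: for the weak limit `f` of the approximating sequence,
`Q±(f,f) ≤ 2 Q∓(f,f) + E`, `E ∈ L¹((0,T) × ℝ^d × ℝ^d)`) was proved in `DiPernaLionsGainLeLoss`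
granted the velocity-averaging lemma CIP 5.3.9
(`diPernaLions_limit_gain_le_loss_of_velocityAverage`); that lemma is now proved
(`velocityAverage_relativelyCompact_L1_holds`, `VelocityAveragingProofs`), so (E49) is discharged
here: `diPernaLions_limit_gain_le_loss_holds`. With it, the weak limit is a mild solution
(`diPernaLions_limit_isAEMildSolution`, CIP Lemma 5.3.12 + Step 14) as soon as the exponential
form (L12) `diPernaLions_limit_expDuhamel` is established
(`diPernaLions_limit_isAEMildSolution_of_expDuhamel`, from the proved assembly
`diPernaLions_limit_isAEMildSolution_of'`). Everything in this file is proved.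

## References

* C. Cercignani, R. Illner, M. Pulvirenti, *The Mathematical Theory of Dilute Gases*, Springer
  (1994), §5.3 Lemma 5.3.9 (p. 154), Lemma 5.3.12 (p. 157), Step 14 (3.46)–(3.49) (pp. 159–160).
* R. J. DiPerna, P.-L. Lions, *On the Cauchy problem for Boltzmann equations: global existence and
  weak stability*, Ann. of Math. 130 (1989) 321–366.
-/

namespace Literature.MathematicalPhysics.KineticTheory

universe u

/-- **(E49) discharged** (CIP 1994 §5.3 Step 14, (3.46)–(3.49), pp. 159–160): in the setting of
`diPernaLions_extraction`, every weak limit `f` satisfies `Q₊(f,f) ≤ 2 Q₋(f,f) + E_T` and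
`Q₋(f,f) ≤ 2 Q₊(f,f) + E_T` a.e. on `(0,T) × E × E` with `E_T ∈ L¹((0,T) × E × E)`.
Proof: `diPernaLions_limit_gain_le_loss_of_velocityAverage` (the entropy dissipation of the weak
limit is finite, by lower semicontinuity along the approximating sequence — velocity averaging —
and (3.23); then (3.27)/(3.29) for the limit) applied to the proved velocity-averaging lemma
`velocityAverage_relativelyCompact_L1_holds` (CIP Lemma 5.3.9). [cite: CIPDiluteGases1994, §5.3 Step 14 (3.46)–(3.49) (pp. 159–160)] -/
theorem diPernaLions_limit_gain_le_loss_holds : diPernaLions_limit_gain_le_loss.{u} :=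
  diPernaLions_limit_gain_le_loss_of_velocityAverage velocityAverage_relativelyCompact_L1_holds

/-- **(S14) reduced to (L12)** (CIP 1994 §5.3 Lemma 5.3.12 and Step 14 (3.44)–(3.49),
pp. 157–160): granted the exponential form of the weak limit (L12,
`diPernaLions_limit_expDuhamel`, CIP Lemma 5.3.12), every DiPerna–Lions weak limit is a mild
solution with `Q±(f,f)/(1+f) ∈ L¹([0,T] × E × B_R)` (`diPernaLions_limit_isAEMildSolution`).
Proof: the proved assembly `diPernaLions_limit_isAEMildSolution_of'` with (E49) discharged
(`diPernaLions_limit_gain_le_loss_holds`). [cite: CIPDiluteGases1994, §5.3 Lemma 5.3.12 and Step 14 (3.44)–(3.49) (pp. 157–160)] -/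
theorem diPernaLions_limit_isAEMildSolution_of_expDuhamel
    (hL12 : diPernaLions_limit_expDuhamel.{u}) : diPernaLions_limit_isAEMildSolution.{u} :=
  diPernaLions_limit_isAEMildSolution_of' diPernaLions_limit_gain_le_loss_holds hL12

end Literature.MathematicalPhysics.KineticTheory
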